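import Summits.BirchSwinnertonDyer.Rank1Residual.Additive.X4RankOneKimPartialShape
import Summits.BirchSwinnertonDyer.Rank1Residual.X4.KimTamagawaDefect
import HarnessLib

/-!
# X4 ∧ `r_an = 1`: the rank-one `∂`-clause COMPOSED with the `≥` half of Kim's Conjecture 1.10
# (`X4.KimTamagawaDefectGeAt`, team row T-N10C, consumed) — the TAMAGAWA rows of O7 ∩ X4@3 become
# ONE-Kurihara-number-shaped; FILE 2 of T-a2r1b (sibling of `Additive/X4RankOneKimPartialShape.lean`)
# (cell `b2b-bsdres`, team n1011, sub-target T-a2r1b — lead GO R3-15)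

HONEST FRAMING (cell `b2b-bsdres`, run/shared/lean/b2b/bsd-rank1-residual/, verbatim in every
file): the goal of the cell is to DELETE the COMBINATION-SHAPED residual classes of the
Birch–Swinnerton-Dyer formula for ALL analytic-rank `≤ 1` elliptic curves over `ℚ` — "full BSD
formula for every rank `≤ 1` curve in class `C`" assembled STRICTLY from published theorems — so
that the rank-`≤ 1` remainder becomes exactly the CONSTRUCTION-SHAPED classes, which are TYPED
(missing-input `Prop`s), NOT attempted. This is not "finishing BSD". Team n1011: prove what is
provable now; shrink each hard class to its core with data; no claim beyond stated classes;
research routes; census output = EVIDENCE / conjecture items, never a Literature fact. X4 stays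
CONSTRUCTION-SHAPED; nothing here is booked; §I O7 / N11 unchanged. Theorems only (the three `@[conjecture]`
defs live in FILE 1); NO Literature fact minted; every published input and every conjecture
is an explicit hypothesis; `#print axioms` standard.

## Why (the O7 ∩ X4@3 rank-one anatomy, `HOME/b2b-bsdres-n1011-p17/census/O7-X4AT3-RANKONE-ANATOMY.md`,
single-engine join + kit j121082, UNCERTIFIED): of the 10 692 S-b X4 ∧ `p = 3` ∧ `r_an = 1` pairs,
the unit / level-two certificate shapes of `X4SharpThreeKimRankOne*` (p249591 / p249974) reach at
most 1 575 + 561; **7 903 (74 %) have `ord₃ ∏_ℓ c_ℓ ≥ 2` with `3 ∤ #Ш_an`** (the 3-part of `∏c` sits on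
two primes on 7 589 of them, `c₃ = 3` at Kodaira IV/IV* on 3 891). On such a row NO unit Kurihara
number exists if Kim's Conjecture 1.10 holds (`∂^{(∞)} = ord_p ∏c ≥ 2`), and a level-`k` certificate
bounds `ord_p #Ш ≤ k − 1` only — useless for `k − 1 ≥ 2`. What those rows need is clause (6) WITH ITS
`∂^{(∞)}` TERM plus the `≥` half of Conjecture 1.10: then a certificate at the RIGHT level
`k = ord_p ∏c + 1` gives `ord_p #Ш ≤ (k − 1) − ord_p ∏c = 0`.

## What this file does

* §0 `∂`-bookkeeping over cc-typer-1's invariants (`Literature/…/KuriharaNumberInvariants.lean`):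
  `kuriharaDivIndex_le_of_kuriharaNumber_ne_zero` (a Kurihara number non-zero mod `p^k` at a level
  `n ∈ 𝒩_k` has divisibility index `≤ k − 1`), `isCyclicKolyvaginLevel_of_prime`,
  `kuriharaPartial_one_le_of_kuriharaNumber_ne_zero` (`∂^{(1)} ≤ k − 1` from ONE prime-level
  certificate).
* §1 `KimRankOnePartialAt W p` (`@[conjecture]`, per pair, p-generic; T-a2's binder convention:
  `Surj W p →`, tower, `L(E,1) = 0`, `r_an = 1`, `Ш` finite, datum `D` with `p ∤ c_D`, period
  transfer): **`∂^{(1)}(δ̃) ≠ ∞ ⟹ length_{ℤ_p} Ш(E/ℚ)[p^∞] + ∂^{(∞)}(δ̃) = ∂^{(1)}(δ̃)`** in `ℕ∞` —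
  Kim 2026 Thm. 1.9 (6) in analytic rank `1` (`ord(δ̃) = 1` is witnessed by `δ̃_1 = L(E,1)/Ω = 0`
  and `∂^{(1)} < ∞`) with its `∂^{(∞)}` term KEPT (the tree's rank-one facts and p249591 are its
  corollaries at `∂^{(1)} ∈ {0, ≤ 1}`). PRINTED for `p ≥ 5` (a STATEMENT of the refereed paper; the
  tree has not typed clause (6) in `∂`-currency yet — cc-typer-1's T1 — so no `_of_five_le` here;
  when that fact lands the sanity lemma is one line); ANNOUNCED for `p ≥ 3` under large image
  (Kim 2025 Thm. 1.1 (Str), PREPRINT, flag `Kim2025-preprint`); at `p = 3` OUR CONJECTURE.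
  Closures `KimThreeRankOnePartial` (every `E`) and `X4SharpThreeKimRankOnePartial` (`Addv W 3`).
* §2 anti-drift inside T-a2r1's family: `kimRankOneUnitAt_of_partial`,
  `kimRankOneLevelTwoAt_of_partial` — the `∂`-currency statement REFINES the two landed shapes.
* §3 the composition with the `≥` half of Conjecture 1.10 (p12's `X4.KimTamagawaDefectGeAt W p D.f`,
  T-N10C, rank-agnostic — CONSUMED, not re-typed, lead R3-15 name discipline):
  `padicValNat_primaryComponent_add_le_of_partial_of_tamagawaDefectGe` (`ord_p #Ш(p) + ord_p ∏c ≤ k − 1`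
  from ONE `δ̃_ℓ ≢ 0 (mod p^k)` at a cyclic `ℓ ∈ 𝒫_k`), hence `card_primaryComponent_eq_one_…`
  at the exact level `k = ord_p ∏c + 1`, the `+2` level with Cassels–Tate parity, and `BSD(E,p)` on
  the `p ∤ #Ш_an` rows; the level-side PREDICTION `kuriharaNumber_eq_zero_of_tamagawaDefectGe_of_level_le`
  (the `≥` half of Conj. 1.10 alone forbids a non-zero `δ̃_ℓ^{(k)}` at any cyclic prime of level
  `k ≤ ord_p ∏c`, rank-free; what the rank-one clause adds is the USE of a non-zero value AT level
  `ord_p ∏c + 1` — whose EXISTENCE in rank one at an additive `p` no source announces: Kim 2025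
  Thm. 1.2 (rk1+ε) needs `p² ∤ N`).
* §4 the `p = 3` census shapes on the TAM rows of O7 ∩ X4@3 (`X4RankOne.bsdp_three_of_partial_…`),
  tower certificate by `towerSurj_three_of_surj_of_jWitness_or_nine`, optimal-datum form by
  `X4.periodTransfer_of_optimal` (`hopt` + `3 ∤ c_D` explicit).

Nothing here is a class theorem; the two conjectures are explicit hypotheses of every theorem; the
EXOTIC (no tower) and NONSURJ rows stay outside; nothing booked.

References: Kim 2026 [Kim2022StructureSelmer] Thm. 1.9 (6), §1.5.1, Conj. 1.10, Def. 2.13, Thm. 2.14;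
Kim 2025 [Kim2025RefinedTNC] Thm. 1.1 (PREPRINT); Sakamoto 2024 [Sakamoto2024KolyvaginThree];
Büyükboduk, JNT 129 (2009) Cor. 3.3 (Tamagawa defect, `p > 3`; not used, named); Cassels 1962 /
Silverman AEC X.4.14 [SilvermanAEC2009]; Miller 2011 [Miller2011LMS] Def. 1.1; cells/n1011/PLAN.md
R3-15 (GO), OWNERS T-a2r1b, T-N10C.
-/

noncomputable section

open scoped Classical MatrixGroups ModularForm

open CongruenceSubgroup WeierstrassCurve Literature.NumberTheory.EllipticCurves
  Literature.NumberTheory.EllipticCurves.ModularForms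
  Literature.NumberTheory.EllipticCurves.Rank1Residual
  Literature.NumberTheory.EllipticCurves.Rank1Residual.Typed

namespace Summit.BirchSwinnertonDyer.Rank1Residual.Additive
/-! ## §3 Composition with the `≥` half of Kim's Conjecture 1.10 (T-N10C, consumed): the TAM rows -/

section Tamagawa

variable (W : WeierstrassCurve ℚ) [W.IsElliptic] [W.IsGloballyMinimal] (p : ℕ) [Fact p.Prime]

/-- **`ord_p #Ш(E/ℚ)(p) + ord_p ∏_ℓ c_ℓ ≤ k − 1` from ONE Kurihara number non-zero mod `p^k`**, granted
the rank-one `∂`-clause `KimRankOnePartialAt W p` (`length + ∂^{(∞)} = ∂^{(1)}`) and the `≥` half of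
Kim's Conjecture 1.10 `X4.KimTamagawaDefectGeAt W p D.f` (`ord_p ∏c ≤ ∂^{(∞)}`): the certificate
gives `∂^{(1)} ≤ k − 1` (§0). ANY reduction at `p`; per pair; BOTH conjectures explicit.
[cite: Kim2022StructureSelmer, Thm. 1.9 (6), Conj. 1.10 (PDF p. 8)] -/
theorem padicValNat_primaryComponent_add_le_of_partial_of_tamagawaDefectGe
    (hK : KimRankOnePartialAt W p)
    (hsurj : W.HasSurjectiveModNGaloisRep p)
    (htower : ∀ n : ℕ, W.HasSurjectiveModNGaloisRep (p ^ n : ℕ)) (hL : W.entireLFunction 1 = 0)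
    (hr : W.analyticRank = 1) (hfin : Finite W.sha)
    {N : ℕ} [NeZero N] (D : ModularParametrizationData W N) (hc : ¬ (p : ℤ) ∣ D.maninConstant)
    (hper : ∃ u : ℚ, ‖(u : ℚ_[p])‖ = 1 ∧ W.realPeriodRat = u * plusPeriod D.f)
    (hGe : X4.KimTamagawaDefectGeAt W p D.f)
    {k : ℕ} (hk : 1 ≤ k) (ℓ : ℕ) [Fact ℓ.Prime] (hℓ : Kato.IsKolyvaginPrime W p k ℓ)
    (hcyc : Nat.card {P : ((WeierstrassCurve.integralModelInt W).map
        (Int.castRingHom (ZMod ℓ))).toAffine.Point // p • P = 0} ≤ p)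
    (ψ : (ℓ' : ℕ) → (ZMod ℓ')ˣ →* Multiplicative (ZMod (p ^ k)))
    (hψ : Function.Surjective (ψ ℓ)) (hδ : kuriharaNumber D.f (p ^ k) ℓ ψ ≠ 0) :
    padicValNat p (Nat.card (AddCommGroup.primaryComponent W.sha p)) +
      padicValNat p W.tamagawaProduct ≤ k - 1 := by
  have h1 : kuriharaPartial W p D.f 1 ≤ ((k - 1 : ℕ) : ℕ∞) :=
    kuriharaPartial_one_le_of_kuriharaNumber_ne_zero W p D.f hk hℓ hcyc ψ hψ hδ
  have hne : kuriharaPartial W p D.f 1 ≠ ⊤ := ne_top_of_le_ne_top (ENat.coe_ne_top _) h1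
  have hmain := hK hsurj htower hL hr hfin D hc hper hne
  have h2 : (padicValNat p (Nat.card (AddCommGroup.primaryComponent W.sha p)) : ℕ∞) +
      (padicValNat p W.tamagawaProduct : ℕ∞) ≤ ((k - 1 : ℕ) : ℕ∞) := by
    calc (padicValNat p (Nat.card (AddCommGroup.primaryComponent W.sha p)) : ℕ∞) +
          (padicValNat p W.tamagawaProduct : ℕ∞)
        ≤ (padicValNat p (Nat.card (AddCommGroup.primaryComponent W.sha p)) : ℕ∞) +
            kuriharaPartialInfty W p D.f := add_le_add le_rfl hGe
      _ = kuriharaPartial W p D.f 1 := hmain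
      _ ≤ ((k - 1 : ℕ) : ℕ∞) := h1
  exact_mod_cast h2

/-- **The EXACT level closes the row**: with `k = ord_p ∏c_ℓ + 1` (a Kurihara number non-zero modulo
`p^{ord_p ∏c + 1}` at a cyclic `ℓ ∈ 𝒫_{ord_p ∏c + 1}` — of `p`-adic valuation exactly `ord_p ∏c`, as
Conjecture 1.10 predicts), `#Ш(E/ℚ)(p) = 1`. Granted both conjectures; per pair; any reduction.
[cite: Kim2022StructureSelmer, Thm. 1.9 (6), Conj. 1.10 (PDF p. 8)] -/
theorem card_primaryComponent_eq_one_of_partial_of_tamagawaDefectGe (hK : KimRankOnePartialAt W p)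
    (hsurj : W.HasSurjectiveModNGaloisRep p)
    (htower : ∀ n : ℕ, W.HasSurjectiveModNGaloisRep (p ^ n : ℕ)) (hL : W.entireLFunction 1 = 0)
    (hr : W.analyticRank = 1) (hfin : Finite W.sha)
    {N : ℕ} [NeZero N] (D : ModularParametrizationData W N) (hc : ¬ (p : ℤ) ∣ D.maninConstant)
    (hper : ∃ u : ℚ, ‖(u : ℚ_[p])‖ = 1 ∧ W.realPeriodRat = u * plusPeriod D.f)
    (hGe : X4.KimTamagawaDefectGeAt W p D.f)
    (ℓ : ℕ) [Fact ℓ.Prime] (hℓ : Kato.IsKolyvaginPrime W p (padicValNat p W.tamagawaProduct + 1) ℓ)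
    (hcyc : Nat.card {P : ((WeierstrassCurve.integralModelInt W).map
        (Int.castRingHom (ZMod ℓ))).toAffine.Point // p • P = 0} ≤ p)
    (ψ : (ℓ' : ℕ) → (ZMod ℓ')ˣ →* Multiplicative (ZMod (p ^ (padicValNat p W.tamagawaProduct + 1))))
    (hψ : Function.Surjective (ψ ℓ))
    (hδ : kuriharaNumber D.f (p ^ (padicValNat p W.tamagawaProduct + 1)) ℓ ψ ≠ 0) :
    Nat.card (AddCommGroup.primaryComponent W.sha p) = 1 := by
  haveI : Finite W.sha := hfin
  have h := padicValNat_primaryComponent_add_le_of_partial_of_tamagawaDefectGe W p hK hsurj htower hL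
    hr hfin D hc hper hGe (by omega) ℓ hℓ hcyc ψ hψ hδ
  exact card_primaryComponent_eq_one_of_padicValNat_eq_zero W p (by omega)

/-- **`BSD(E,p)` on a TAM row from ONE Kurihara number at the exact level**, granted the two
conjectures, Gross–Zagier–Kolyvagin and modularity, with `#Ш_an = q` a `p`-unit. ANY reduction at
`p`; per pair; NOT a class theorem; nothing booked. [cite: Kim2022StructureSelmer, Thm. 1.9 (6), Conj. 1.10 (PDF p. 8)]
[cite: Miller2011LMS, Def. 1.1] -/
theorem bsdp_of_partial_of_tamagawaDefectGe_of_shaAn_unit (hK : KimRankOnePartialAt W p)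
    (hGZK : rank_eq_analyticRank_of_analyticRank_le_one) (hmod : hasEntireLFunction_rat)
    (hsurj : W.HasSurjectiveModNGaloisRep p)
    (htower : ∀ n : ℕ, W.HasSurjectiveModNGaloisRep (p ^ n : ℕ)) (hr : W.analyticRank = 1)
    {N : ℕ} [NeZero N] (D : ModularParametrizationData W N) (hc : ¬ (p : ℤ) ∣ D.maninConstant)
    (hper : ∃ u : ℚ, ‖(u : ℚ_[p])‖ = 1 ∧ W.realPeriodRat = u * plusPeriod D.f)
    (hGe : X4.KimTamagawaDefectGeAt W p D.f)
    (ℓ : ℕ) [Fact ℓ.Prime] (hℓ : Kato.IsKolyvaginPrime W p (padicValNat p W.tamagawaProduct + 1) ℓ)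
    (hcyc : Nat.card {P : ((WeierstrassCurve.integralModelInt W).map
        (Int.castRingHom (ZMod ℓ))).toAffine.Point // p • P = 0} ≤ p)
    (ψ : (ℓ' : ℕ) → (ZMod ℓ')ˣ →* Multiplicative (ZMod (p ^ (padicValNat p W.tamagawaProduct + 1))))
    (hψ : Function.Surjective (ψ ℓ))
    (hδ : kuriharaNumber D.f (p ^ (padicValNat p W.tamagawaProduct + 1)) ℓ ψ ≠ 0)
    {q : ℚ} (hq : shaAn W = (q : ℂ)) (hv : padicValRat p q = 0) : BSDp W p := by
  have hL : W.entireLFunction 1 = 0 := by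
    by_contra hne
    have h0 := (W.analyticRank_eq_zero_iff_holds (hmod W)).mpr hne
    omega
  obtain ⟨hmw, hfin⟩ := hGZK W (by rw [hr])
  have hcard := card_primaryComponent_eq_one_of_partial_of_tamagawaDefectGe W p hK hsurj htower hL hr
    hfin D hc hper hGe ℓ hℓ hcyc ψ hψ hδ
  exact (X4.bsdp_iff_padicValRat_eq_zero_of_card_primaryComponent_eq_one W p hmw hfin hcard hq).mpr hv

/-- **One level up, Cassels–Tate parity**: a Kurihara number non-zero modulo `p^{ord_p ∏c + 2}` at a
cyclic `ℓ ∈ 𝒫_{ord_p ∏c + 2}` gives `ord_p #Ш(p) ≤ 1`, and the squareness of `#Ш` (`hCT`, `Ш`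
finite) forces `ord_p #Ш = 0`. Granted both conjectures; per pair; any reduction.
[cite: Kim2022StructureSelmer, Thm. 1.9 (6), Conj. 1.10 (PDF p. 8)] [cite: SilvermanAEC2009, Thm. X.4.14] -/
theorem padicValNat_shaOrder_eq_zero_of_partial_of_tamagawaDefectGe_succ_of_casselsTate
    (hK : KimRankOnePartialAt W p) (hCT : exists_casselsTate_pairing (K := ℚ))
    (hGZK : rank_eq_analyticRank_of_analyticRank_le_one) (hmod : hasEntireLFunction_rat)
    (hsurj : W.HasSurjectiveModNGaloisRep p)
    (htower : ∀ n : ℕ, W.HasSurjectiveModNGaloisRep (p ^ n : ℕ)) (hr : W.analyticRank = 1)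
    {N : ℕ} [NeZero N] (D : ModularParametrizationData W N) (hc : ¬ (p : ℤ) ∣ D.maninConstant)
    (hper : ∃ u : ℚ, ‖(u : ℚ_[p])‖ = 1 ∧ W.realPeriodRat = u * plusPeriod D.f)
    (hGe : X4.KimTamagawaDefectGeAt W p D.f)
    (ℓ : ℕ) [Fact ℓ.Prime] (hℓ : Kato.IsKolyvaginPrime W p (padicValNat p W.tamagawaProduct + 2) ℓ)
    (hcyc : Nat.card {P : ((WeierstrassCurve.integralModelInt W).map
        (Int.castRingHom (ZMod ℓ))).toAffine.Point // p • P = 0} ≤ p)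
    (ψ : (ℓ' : ℕ) → (ZMod ℓ')ˣ →* Multiplicative (ZMod (p ^ (padicValNat p W.tamagawaProduct + 2))))
    (hψ : Function.Surjective (ψ ℓ))
    (hδ : kuriharaNumber D.f (p ^ (padicValNat p W.tamagawaProduct + 2)) ℓ ψ ≠ 0) :
    padicValNat p W.shaOrder = 0 := by
  have hr1 : W.analyticRank ≤ 1 := by rw [hr]
  have hL : W.entireLFunction 1 = 0 := by
    by_contra hne
    have h0 := (W.analyticRank_eq_zero_iff_holds (hmod W)).mpr hne
    omega
  have hfin : W.ShaFinite := (hGZK W hr1).2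
  haveI : Finite W.sha := hfin
  have h := padicValNat_primaryComponent_add_le_of_partial_of_tamagawaDefectGe W p hK hsurj htower hL
    hr hfin D hc hper hGe (by omega) ℓ hℓ hcyc ψ hψ hδ
  have hle : padicValNat p (Nat.card (AddCommGroup.primaryComponent W.sha p)) ≤ 1 := by omega
  rw [padicValNat_card_addPrimaryComponent p] at hle
  have hsq : IsSquare W.shaOrder := isSquare_shaOrder_of_casselsTate hCT W hfin
  have hn : W.shaOrder ≠ 0 := (WeierstrassCurve.shaOrder_pos W hfin).ne'
  by_contra h0
  have hdvd : p ∣ W.shaOrder := by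
    by_contra hnd
    exact h0 (padicValNat.eq_zero_of_not_dvd hnd)
  have h2 : 2 ≤ padicValNat p W.shaOrder := two_le_padicValNat_of_isSquare_of_dvd hsq hn hdvd
  have : padicValNat p W.shaOrder ≤ 1 := by
    unfold WeierstrassCurve.shaOrder; exact hle
  omega

omit [W.IsElliptic] [Fact p.Prime] in
/-- **THE FALSIFIABLE PREDICTION on TAM rows (level side)**: the `≥` half of Kim's Conjecture 1.10
ALONE (`X4.KimTamagawaDefectGeAt W p D.f`: `ord_p ∏c ≤ ∂^{(∞)} ≤ ∂^{(1)}`) forbids a Kurihara number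
non-zero modulo `p^k` at ANY cyclic Kolyvagin prime of level `k ≤ ord_p ∏_ℓ c_ℓ` — in either rank,
with no Kim clause and no BSD input: the first non-zero `δ̃_ℓ^{(k)}` can only appear at
`k ≥ ord_p ∏c + 1` (general-`k`, prime-level form of T-N10C's `not_kuriharaUnitAt_of_kimTamagawaDefectGe_of_dvd`).
What the rank-one clause ADDS is the converse use (§3 above: a non-zero `δ̃_ℓ` AT level
`ord_p ∏c + 1` closes the row); whether such an `ℓ` EXISTS in analytic rank `1` at an additive `p` is
announced by NO source (Kim 2025 Thm. 1.2 (rk1+ε) needs `p² ∤ N`) — the census looks, the kernel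
waits. A non-zero value below the predicted level is an ANOMALY to report.
[cite: Kim2022StructureSelmer, §1.5.1 and Conj. 1.10 (PDF pp. 7–8)] -/
theorem kuriharaNumber_eq_zero_of_tamagawaDefectGe_of_level_le
    {N : ℕ} [NeZero N] (D : ModularParametrizationData W N) (hGe : X4.KimTamagawaDefectGeAt W p D.f)
    {k : ℕ} (hk : 1 ≤ k) (hkv : k ≤ padicValNat p W.tamagawaProduct)
    (ℓ : ℕ) [Fact ℓ.Prime] (hℓ : Kato.IsKolyvaginPrime W p k ℓ)
    (hcyc : Nat.card {P : ((WeierstrassCurve.integralModelInt W).map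
        (Int.castRingHom (ZMod ℓ))).toAffine.Point // p • P = 0} ≤ p)
    (ψ : (ℓ' : ℕ) → (ZMod ℓ')ˣ →* Multiplicative (ZMod (p ^ k)))
    (hψ : Function.Surjective (ψ ℓ)) : kuriharaNumber D.f (p ^ k) ℓ ψ = 0 := by
  by_contra hδ
  have h1 : kuriharaPartial W p D.f 1 ≤ ((k - 1 : ℕ) : ℕ∞) :=
    kuriharaPartial_one_le_of_kuriharaNumber_ne_zero W p D.f hk hℓ hcyc ψ hψ hδ
  have h2 : (padicValNat p W.tamagawaProduct : ℕ∞) ≤ ((k - 1 : ℕ) : ℕ∞) :=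
    le_trans (le_trans hGe (kuriharaPartialInfty_le W p D.f 1)) h1
  have h3 : padicValNat p W.tamagawaProduct ≤ k - 1 := by exact_mod_cast h2
  omega

end Tamagawa

/-! ## §4 The `p = 3` census shapes on the TAM rows of O7 ∩ X4 (modulo the two conjectures) -/

section Three

variable (W : WeierstrassCurve ℚ) [W.IsElliptic] [W.IsGloballyMinimal]

/-- **O7 ∩ X4@3, TAM row, exact-level certificate**: on `ClassX4 W 3` ∧ `r_an = 1` with surj(3) and a
tower certificate (`j`-witness or surj(9)), a datum `D` with `3 ∤ c_D` and the period transfer,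
`v := ord₃ ∏_ℓ c_ℓ` (ANY value), ONE Kurihara number `δ̃_ℓ ≢ 0 (mod 3^{v+1})` at a cyclic
`ℓ ∈ 𝒫_{v+1}(E,3)`, and `#Ш_an = q` a `3`-unit: `BSD(E,3)` — MODULO the two conjectures
`X4SharpThreeKimRankOnePartial` (`h3`) and `X4.KimTamagawaDefectGeAt W 3 D.f` (`hGe`). This is the
shape that reaches the 7 903 TAM rows of the O7 ∩ X4@3 anatomy. Per pair; NOT a class theorem;
nothing booked. [cite: Kim2022StructureSelmer, Thm. 1.9 (6), Conj. 1.10 (PDF p. 8)]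
[cite: SerreAbelianLadic1968, Ch. IV §3.4, Lemma 3 (IV-23)] [cite: Miller2011LMS, Def. 1.1] -/
theorem X4RankOne.bsdp_three_of_partial_of_tamagawaDefectGe_of_cert (h3 : X4SharpThreeKimRankOnePartial)
    (hGZK : rank_eq_analyticRank_of_analyticRank_le_one) (hmod : hasEntireLFunction_rat)
    (hX : ClassX4 W 3) (hsurj : Surj W 3)
    (hcert : (∃ q : ℕ, q.Prime ∧ q ≠ 3 ∧ padicValRat q W.j < 0 ∧ ¬ (3 : ℤ) ∣ padicValRat q W.j) ∨
      W.HasSurjectiveModNGaloisRep 9)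
    (hr : W.analyticRank = 1) {q : ℚ} (hq : shaAn W = (q : ℂ)) (hv : padicValRat 3 q = 0)
    {N : ℕ} [NeZero N] (D : ModularParametrizationData W N) (hc : ¬ (3 : ℤ) ∣ D.maninConstant)
    (hper : ∃ u : ℚ, ‖(u : ℚ_[3])‖ = 1 ∧ W.realPeriodRat = u * plusPeriod D.f)
    (hGe : X4.KimTamagawaDefectGeAt W 3 D.f)
    (ℓ : ℕ) [Fact ℓ.Prime] (hℓ : Kato.IsKolyvaginPrime W 3 (padicValNat 3 W.tamagawaProduct + 1) ℓ)
    (hcyc : Nat.card {P : ((WeierstrassCurve.integralModelInt W).map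
        (Int.castRingHom (ZMod ℓ))).toAffine.Point // 3 • P = 0} ≤ 3)
    (ψ : (ℓ' : ℕ) → (ZMod ℓ')ˣ →* Multiplicative (ZMod (3 ^ (padicValNat 3 W.tamagawaProduct + 1))))
    (hψ : Function.Surjective (ψ ℓ))
    (hδ : kuriharaNumber D.f (3 ^ (padicValNat 3 W.tamagawaProduct + 1)) ℓ ψ ≠ 0) : BSDp W 3 :=
  bsdp_of_partial_of_tamagawaDefectGe_of_shaAn_unit W 3 (kimRankOnePartialAt_three_of_classX4 W h3 hX)
    hGZK hmod hsurj (towerSurj_three_of_surj_of_jWitness_or_nine W hsurj hcert) hr D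
    (by exact_mod_cast hc) hper hGe ℓ hℓ hcyc ψ hψ hδ hq hv

/-- **O7 ∩ X4@3, TAM row, exact-level certificate, OPTIMAL datum** (period binder discharged by
`X4.periodTransfer_of_optimal`; `hopt` and `3 ∤ c_D` stay explicit — referee 1 ACK-1 T-a2r1 proviso
(2)). Per pair; nothing booked. [cite: Kim2022StructureSelmer, Thm. 1.9 (6), Conj. 1.10 (PDF p. 8)]
[cite: CremonaAlgorithms1997, §2.8 (p. 26)] [cite: Miller2011LMS, Def. 1.1] -/
theorem X4RankOne.bsdp_three_of_partial_of_tamagawaDefectGe_of_cert_of_optimal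
    (h3 : X4SharpThreeKimRankOnePartial)
    (hGZK : rank_eq_analyticRank_of_analyticRank_le_one) (hmod : hasEntireLFunction_rat)
    (hX : ClassX4 W 3) (hsurj : Surj W 3)
    (hcert : (∃ q : ℕ, q.Prime ∧ q ≠ 3 ∧ padicValRat q W.j < 0 ∧ ¬ (3 : ℤ) ∣ padicValRat q W.j) ∨
      W.HasSurjectiveModNGaloisRep 9)
    (hr : W.analyticRank = 1) {q : ℚ} (hq : shaAn W = (q : ℂ)) (hv : padicValRat 3 q = 0)
    {N : ℕ} [NeZero N] (D : ModularParametrizationData W N)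
    (hopt : ∀ z ∈ D.L.lattice, ∃ w ∈ periodLattice D.f, z = D.c * w)
    (hc : ¬ (3 : ℤ) ∣ D.maninConstant) (hGe : X4.KimTamagawaDefectGeAt W 3 D.f)
    (ℓ : ℕ) [Fact ℓ.Prime] (hℓ : Kato.IsKolyvaginPrime W 3 (padicValNat 3 W.tamagawaProduct + 1) ℓ)
    (hcyc : Nat.card {P : ((WeierstrassCurve.integralModelInt W).map
        (Int.castRingHom (ZMod ℓ))).toAffine.Point // 3 • P = 0} ≤ 3)
    (ψ : (ℓ' : ℕ) → (ZMod ℓ')ˣ →* Multiplicative (ZMod (3 ^ (padicValNat 3 W.tamagawaProduct + 1))))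
    (hψ : Function.Surjective (ψ ℓ))
    (hδ : kuriharaNumber D.f (3 ^ (padicValNat 3 W.tamagawaProduct + 1)) ℓ ψ ≠ 0) : BSDp W 3 :=
  X4RankOne.bsdp_three_of_partial_of_tamagawaDefectGe_of_cert W h3 hGZK hmod hX hsurj hcert hr hq hv D hc
    (X4.periodTransfer_of_optimal 3 D hopt (by exact_mod_cast hc)) hGe ℓ hℓ hcyc ψ hψ hδ

end Three

end Summit.BirchSwinnertonDyer.Rank1Residual.Additive

end
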